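import Summits.BirchSwinnertonDyer.BirchSwinnertonDyer.Theorems.EisensteinPrimesBSDpOnCellCTelescopeK2XBigDecompCellC
import Summits.BirchSwinnertonDyer.BirchSwinnertonDyer.Theorems.EisensteinPrimesBSDpOnCellCTelescopeK2FinitelyDecomposedFrobenius
import Summits.BirchSwinnertonDyer.BirchSwinnertonDyer.Theorems.EisensteinPrimesBSDpOnCellCTelescopeK2SelmerCofinite
import Summits.BirchSwinnertonDyer.BirchSwinnertonDyer.Theorems.EisensteinPrimesBSDpOnCellCTelescopeK2BigRepCofinite
import Summits.BirchSwinnertonDyer.BirchSwinnertonDyer.Theorems.EisensteinPrimesBSDpOnCellCTelescopeK2FibreCofinite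
import Summits.BirchSwinnertonDyer.BirchSwinnertonDyer.Theorems.EisensteinPrimesAcTwistDeformationCofree
import Summits.BirchSwinnertonDyer.BirchSwinnertonDyer.Theorems.EisensteinPrimesBSDpOnCellCTelescopeK2RepDescent
import Summits.BirchSwinnertonDyer.BirchSwinnertonDyer.Theorems.EisensteinPrimesGoodLatticeQuotCharUnramified
import Summits.BirchSwinnertonDyer.BirchSwinnertonDyer.Theorems.EisensteinPrimesBSDpOnCellCTelescopeK2ModuleDivOfLeaves
import Literature.NumberTheory.EllipticCurves.BigGaloisRepSelmerSigmaChangeProofs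
import Literature.NumberTheory.EllipticCurves.JetchevSkinnerWan2017.SigmaLocalFinitelyDecomposedProofs
import Literature.NumberTheory.EllipticCurves.Castella2018.SigmaSelmerUnramifiedOutsideSProofs
import Literature.NumberTheory.EllipticCurves.PrimaryTorsionLocalGoodReductionFrobeniusProofs
import HarnessLib

/-!
# Crux 4 `BSDpOnCellC` (stmt-BirchSwinnertonDyer-19034), line «telescope», leaf N2|pub sub-leaf W3 — THE E-SIDE INPUT (I-E) FROM THE REFEREED NAMES:
# the UNRAMIFIED big Selmer dual `X^{unr,∅}(E) = XBig κ (E[p^∞]) 𝔭̄ ∅` is finitely generated and `Λ`-torsion on Cell C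
# (successor LEAD `cruxlead-19034` g3; `--supports`, helper; THEOREMS ONLY; CONDITIONAL on GZK + «newform exists»)

HONEST FRAMING. No registered stub, no crux, no summit statement is proved; BSD is proved for no curve. CONDITIONAL on the two refereed
named facts it takes as hypotheses — `rank_eq_analyticRank_of_analyticRank_le_one` (Gross–Zagier–Kolyvagin) and `exists_isNewformOf`
(modularity) — conjuncts 10 and 6 of the telescope's cite stub `stub_publishedFacts`, which leaf N2|pub (`stub_weightTwoControlOfPub`,
telescope v10) holds. This file DISCHARGES the E-side input (I-E) of the LEAD's W3 kernel
`TelescopeK2WeightTwoTransportOfInputs.weightTwoTransport_of_inputs : (I-E) → (W3-fg) → W3` (p751200); with ideator bsd-idea-12 g37's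
`TelescopeK2WeightTwoFg.weightTwoTransport_of_E : (I-E) → W3` (p752319, (W3-fg) discharged by cofinite generation) the sub-leaf W3
`K2Weight2.stub_weightTwoTransport` becomes a theorem UNDER the two refereed names.

* **`inputE_of_pub (hGZK) (hnf) : <(I-E) verbatim>`** — for the road-R-β prefix of W3 through `((p).primesOver (𝓞 K)).ncard = 2` and every topology on
  `Λ = ℤ_p⟦T⟧` making `E[p^∞] ⊗ Λ^*` a topological module (`E = W.baseChange K`): `XBig κ (E.primaryTorsionGaloisRep p) 𝔭̄ ∅` is
  finitely generated
  and torsion over `Λ`. ROUTE (every ingredient a tree theorem): (a) the STRICT dual `X^{dec,∅}` is f.g. torsion (`TelescopeK2XBigDecompCellC`,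
  p751516: `isTorsion_xAc_other_of_cellC` + `XAc.module_finite_empty` + Shapiro); (b) the finite set `F` of places `w ∋ N`, `w ∌ p` (the bad places
  of `E/K` off `p`; `Ideal.finite_factors`); off `F ∪ {w ∣ p}` the big module is unramified (`Castella2018.anticyclotomicBigRep_localMap_inr_apply` ∘
  `WeierstrassCurve.primaryTorsionGaloisRep_localMap_inr_apply` ∘ `EisensteinPrimesMuLambda.hasGoodReductionAt_baseChange_of_conductorNorm_notMem`),
  so `X^{unr,Σ}` and `X^{dec,Σ}` are f.g. for every `Σ ⊆ F` (`TelescopeK2SelmerCofinite.module_finite_XBig`, p748332, with cofinite generation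
  `TelescopeK2BigRepCofinite.isCofinitelyGenerated_bigRepModule_of_torsion` + `TelescopeK2FibreCofinite.finite_torsionBy_primaryTorsion_geomPoints`,
  ideator g37, and `TelescopeK2RepDescent.ramificationSubgroup_le_ker_of_forall_localMap`, ideator g36); (c) the Σ-change `∅ → F` on the strict
  duals (`BigGaloisRep.XBigDecomp.isTorsion_and_charIdeal_mul_span_prod_le`) with the UNCONDITIONAL local terms
  `JetchevSkinnerWan2017.sigmaLocal_dual_of_ne_zero` at each `w ∈ F`, fed by the Frobenius datum of `TelescopeK2FinitelyDecomposedFrobenius`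
  (p751992; `w` has degree one because its rational prime divides `N`, hence splits in `K` — Heegner — `X11b.degreeOne_of_splitsIn`); so
  `X^{dec,F}` is torsion; (d) `Sel^{unr,∅} ≤ Sel^{dec,F}` because `ℋ^{ur}_w = 0` at the good places `w ∉ F`, `w ∤ p`
  (`Castella2018.resH1_anticyclotomicBigRep_localMap_inl_eq_zero_of_inr`, `p ≠ 2` on Cell C), hence `X^{dec,F} ↠ X^{unr,∅}` and the latter is
  finitely generated and torsion.

References: F. Castella, Camb. J. Math. 6 (2018) §2.2, Def. 2.2, Thm. 2.3 [Castella2018]; Jetchev–Skinner–Wan, Camb. J. Math. 5 (2017) Thm. 3.3.1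
[JetchevSkinnerWan2017]; R. Greenberg–V. Vatsal, Invent. Math. 142 (2000) Prop. 2.4 [GreenbergVatsal2000]; D. Brink, Math. Comp. 76 (2007) Thm. 2
[Brink2007]; C. Skinner, Pacific J. Math. 283 (2016) §2.3 [Skinner2016PacificMC].
-/

set_option autoImplicit false
set_option linter.dupNamespace false

noncomputable section

open scoped Classical MatrixGroups ModularForm

open CongruenceSubgroup WeierstrassCurve NumberField IsDedekindDomain Field PowerSeries
  Literature.NumberTheory.EllipticCurves Literature.NumberTheory.EllipticCurves.GreenbergSelmer
  Literature.NumberTheory.EllipticCurves.ModularForms Literature.NumberTheory.QuadraticFields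
  Literature.NumberTheory.EllipticCurves.Rank1Residual
  Literature.NumberTheory.EllipticCurves.Rank1Residual.Typed
  Literature.NumberTheory.GaloisRepresentations Literature.NumberTheory.GaloisCohomology
  Summit.BirchSwinnertonDyer.Rank1Residual.X11b.AcSelmer
  Summit.BirchSwinnertonDyer.Rank1Residual.X11b.Halves
  Summit.BirchSwinnertonDyer.Rank1Residual.X11b
  Summit.BirchSwinnertonDyer.Rank1Residual Summit.BirchSwinnertonDyer.Rank1Residual.X1
  Summit.BirchSwinnertonDyer.Rank1Residual.X2

open Literature.NumberTheory.IwasawaTheory Literature.NumberTheory.IwasawaTheory.Greenberg2006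
open Literature.NumberTheory.EllipticCurves.BigGaloisRep
open Literature.NumberTheory.EllipticCurves.Castella2018

namespace Summit.BirchSwinnertonDyer.BirchSwinnertonDyer.Theorems.TelescopeK2XBigUnramifiedCellC

open Summit.BirchSwinnertonDyer.BirchSwinnertonDyer.Theorems

/-- `ContinuousSMul ℤ_p A[p^∞]` for the discrete `p`-primary torsion of any abelian group: `c • a` only depends on
`c mod p^{level a}`, so each orbit map is locally constant (the tree's `WeakLeopoldtAboveCurve.continuousSMul_primaryTorsion`,
re-proved here to keep this file's imports light). [cite: Serre1968, Ch. I §1.2] -/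
private theorem continuousSMul_primaryTorsion {A : Type*} [AddCommGroup A] {p : ℕ} [Fact p.Prime] :
    ContinuousSMul ℤ_[p] (PrimaryTorsion A p) := by
  -- adapted from Theorems/EisensteinPrimesWeakLeopoldtAboveCurve.lean §1
  refine ⟨continuous_prod_of_discrete_right.mpr fun a => ?_⟩
  refine (IsLocallyConstant.iff_eventually_eq _).mpr (fun c₀ => ?_) |>.continuous
  have hU : IsOpen {c : ℤ_[p] | c - c₀ ∈ Ideal.span {(p : ℤ_[p]) ^ a.level}} := by
    have : {c : ℤ_[p] | c - c₀ ∈ Ideal.span {(p : ℤ_[p]) ^ a.level}} =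
        (fun c : ℤ_[p] => c - c₀) ⁻¹' Metric.closedBall (0 : ℤ_[p]) ((p : ℝ) ^ (-(a.level : ℤ))) := by
      ext c
      simp only [Set.mem_setOf_eq, Set.mem_preimage, Metric.mem_closedBall, dist_zero_right,
        PadicInt.norm_le_pow_iff_mem_span_pow]
    rw [this]
    refine (IsUltrametricDist.isOpen_closedBall (0 : ℤ_[p]) ?_).preimage (by fun_prop)
    exact (zpow_pos (by exact_mod_cast (Fact.out : p.Prime).pos) _).ne'
  filter_upwards [hU.mem_nhds (by simp)] with c hc
  have hker : PadicInt.toZModPow a.level (c - c₀) = 0 := by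
    rw [← RingHom.mem_ker, PadicInt.ker_toZModPow]
    exact hc
  have heq : PadicInt.toZModPow a.level c = PadicInt.toZModPow a.level c₀ := by
    rwa [map_sub, sub_eq_zero] at hker
  apply PrimaryTorsion.ext
  rw [PrimaryTorsion.val_smul, PrimaryTorsion.val_smul, IwasawaDual.zpT_def, IwasawaDual.zpT_def, heq]

/-- **(I-E) from GZK + modularity: the unramified big Selmer dual of `E = W_K` is finitely generated and `Λ`-torsion on Cell C** — the statement
is the hypothesis `hE` of `TelescopeK2WeightTwoTransportOfInputs.weightTwoTransport_of_inputs` VERBATIM. See the module docstring for the route.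
[cite: Castella2018, Thm. 2.3 (first clause) and §2.2] [cite: JetchevSkinnerWan2017, Thm. 3.3.1] [cite: GreenbergVatsal2000, Prop. 2.4] -/
theorem inputE_of_pub (hGZK : rank_eq_analyticRank_of_analyticRank_le_one) (hnf : exists_isNewformOf) :

    ∀ (W : WeierstrassCurve ℚ) [W.IsElliptic] [W.IsGloballyMinimal] (p : ℕ) [Fact p.Prime],
    ∀ (N : ℕ) [NeZero N] (K : Type) [Field K] [NumberField K] (Dt : ModularParametrizationData W N)
      (H : HeegnerDatum N (NumberField.discr K)) (ιK : K →+* ℂ) (P : (W.baseChange K).toAffine.Point),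
      CellC W p → W.conductorNorm ℤ = N →
      IsImaginaryQuadratic K → NumberField.discr K < -4 → SatisfiesHeegnerHypothesis N K →
      (W.quadraticTwist (NumberField.discr K : ℚ)).entireLFunction 1 ≠ 0 →
      WeierstrassCurve.Affine.Point.map ιK.toRatAlgHom P = heegnerPointComplex Dt H →
      ¬ (p : ℤ) ∣ Dt.c → ¬ IsOfFinAddOrder P →
      Odd (NumberField.discr K) →
      ∀ (κ : ZpExtension K p), κ.IsAnticyclotomic →
        ∀ (γ : Field.absoluteGaloisGroup K) [Fact (κ.IsTopGenerator γ)]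
          (𝔭 : HeightOneSpectrum (𝓞 K)), ((p : ℕ) : 𝓞 K) ∈ 𝔭.asIdeal →
          𝔭.asIdeal.ramificationIdx (𝓞 ℚ) = 1 → 𝔭.asIdeal.inertiaDeg (𝓞 ℚ) = 1 →
          ∀ (𝔭bar : HeightOneSpectrum (𝓞 K)), ((p : ℕ) : 𝓞 K) ∈ 𝔭bar.asIdeal → 𝔭bar ≠ 𝔭 →
            ((Ideal.span {(p : ℤ)}).primesOver (𝓞 K)).ncard = 2 →
          ∀ [TopologicalSpace (PowerSeries ℤ_[p])]
            [ContinuousSMul (PowerSeries ℤ_[p])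
              (BigRepModule ℤ_[p] p (PrimaryTorsion (W.baseChange K).geomPoints p))],
            Module.Finite (PowerSeries ℤ_[p])
                (XBig κ ((W.baseChange K).primaryTorsionGaloisRep p) 𝔭bar (∅ : Set (HeightOneSpectrum (𝓞 K)))) ∧
              Module.IsTorsion (PowerSeries ℤ_[p])
                (XBig κ ((W.baseChange K).primaryTorsionGaloisRep p) 𝔭bar (∅ : Set (HeightOneSpectrum (𝓞 K)))) := by
  intro W _ _ p _ N _ K _ _ Dt H ιK P hC hN hK hdisc hHeeg hL1 hP hc hfin hodd κ hκ γ _ 𝔭 h𝔭 hram hdeg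
    𝔭bar h𝔭bar hne hsp τ instE
  have hp : p.Prime := Fact.out
  have hp2 : p ≠ 2 := hC.2.1
  haveI : IsTotallyComplex K := hK.2
  have hsplitK : SatisfiesHeegnerHypothesis p K := fun ℓ hℓ hℓp =>
    ((Nat.prime_dvd_prime_iff_eq hℓ hp).mp hℓp).symm ▸ hsp
  have hNK : (((W.conductorNorm ℤ : ℤ)) : 𝓞 K) = ((N : ℕ) : 𝓞 K) := by rw [hN]; push_cast; rfl
  -- good reduction of `(W.baseChange K) = W_K` at every `w` with `N ∉ w`
  have hgood : ∀ w : HeightOneSpectrum (𝓞 K), ((N : ℕ) : 𝓞 K) ∉ w.asIdeal → (W.baseChange K).HasGoodReductionAt w :=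
    fun w hw => EisensteinPrimesMuLambda.hasGoodReductionAt_baseChange_of_conductorNorm_notMem W w
      (by rw [hNK]; exact hw)
  -- inertia acts trivially on `(W.baseChange K)[p^∞]` at such `w ∤ p`
  have hram : ∀ w : HeightOneSpectrum (𝓞 K), ((N : ℕ) : 𝓞 K) ∉ w.asIdeal → ((p : ℕ) : 𝓞 K) ∉ w.asIdeal →
      ∀ (σ : LocalGroup K (Sum.inr w)) (P : PrimaryTorsion (geomPoints (W.baseChange K)) p),
        ((W.baseChange K).primaryTorsionGaloisRep p) (localMap K (Sum.inr w) σ) P = P :=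
    fun w hNw hpw σ P => (W.baseChange K).primaryTorsionGaloisRep_localMap_inr_apply p (hgood w hNw) hpw σ P
  -- (a) the strict dual `X^{dec,∅}` is f.g. torsion (GZK + newform)
  obtain ⟨hfg0, htor0⟩ := TelescopeK2XBigDecompCellC.moduleFinite_isTorsion_XBigDecomp_of_cellC hGZK hnf hC hK
    hsplitK hL1 P hfin κ hκ γ 𝔭bar h𝔭bar
  -- (b) the finite set `F` of bad places not above `p`
  have hN0 : ((N : ℕ) : 𝓞 K) ≠ 0 := by exact_mod_cast (NeZero.ne N)
  have hFfin : {w : HeightOneSpectrum (𝓞 K) | ((N : ℕ) : 𝓞 K) ∈ w.asIdeal ∧ ((p : ℕ) : 𝓞 K) ∉ w.asIdeal}.Finite := by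
    refine (Ideal.finite_factors (I := Ideal.span {((N : ℕ) : 𝓞 K)}) ?_).subset ?_
    · rw [Ne, Ideal.zero_eq_bot, Ideal.span_singleton_eq_bot]; exact hN0
    · intro w hw
      exact (Ideal.dvd_span_singleton).mpr hw.1
  set F : Finset (HeightOneSpectrum (𝓞 K)) := hFfin.toFinset with hFdef
  have hmemF : ∀ w, w ∈ F ↔ ((N : ℕ) : 𝓞 K) ∈ w.asIdeal ∧ ((p : ℕ) : 𝓞 K) ∉ w.asIdeal := fun w => by
    rw [hFdef, Set.Finite.mem_toFinset]; rfl
  -- the finite set `S₀ = F ∪ {w ∣ p}` outside which `M = (W.baseChange K)[p^∞] ⊗ Λ^*` is unramified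
  have hSpfin : {w : HeightOneSpectrum (𝓞 K) | ((p : ℕ) : 𝓞 K) ∈ w.asIdeal}.Finite := by
    refine (Ideal.finite_factors (I := Ideal.span {((p : ℕ) : 𝓞 K)}) ?_).subset ?_
    · rw [Ne, Ideal.zero_eq_bot, Ideal.span_singleton_eq_bot]; exact_mod_cast hp.ne_zero
    · intro w hw; exact (Ideal.dvd_span_singleton).mpr hw
  set S₀ : Set (HeightOneSpectrum (𝓞 K)) := (↑F : Set _) ∪ {w | ((p : ℕ) : 𝓞 K) ∈ w.asIdeal} with hS₀
  have hS₀fin : S₀.Finite := (F.finite_toSet).union hSpfin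
  have hnotS₀ : ∀ w, w ∉ S₀ → ((N : ℕ) : 𝓞 K) ∉ w.asIdeal ∧ ((p : ℕ) : 𝓞 K) ∉ w.asIdeal := by
    intro w hw
    rw [hS₀, Set.mem_union, not_or, Finset.mem_coe, hmemF] at hw
    exact ⟨fun hNw => hw.1 ⟨hNw, hw.2⟩, hw.2⟩
  have hker : ramificationSubgroup K S₀ ≤ (AnticyclotomicBigGaloisRep κ ((W.baseChange K).primaryTorsionGaloisRep p)).ker := by
    refine TelescopeK2RepDescent.ramificationSubgroup_le_ker_of_forall_localMap (S := S₀)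
      (AnticyclotomicBigGaloisRep κ ((W.baseChange K).primaryTorsionGaloisRep p)) fun w hw i => ?_
    obtain ⟨hNw, hpw⟩ := hnotS₀ w hw
    exact LinearMap.ext fun Φ => Castella2018.anticyclotomicBigRep_localMap_inr_apply (W.baseChange K) p κ hpw (hram w hNw hpw) i Φ
  -- cofinite generation of `(W.baseChange K)[p^∞] ⊗ Λ^*`
  have hpK : (p : K) ≠ 0 := Nat.cast_ne_zero.mpr hp.ne_zero
  have hset : Submodule.torsionBySet ℤ_[p] (PrimaryTorsion (geomPoints (W.baseChange K)) p)
      ((IsLocalRing.maximalIdeal ℤ_[p] : Ideal ℤ_[p]) : Set ℤ_[p]) =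
      Submodule.torsionBy ℤ_[p] (PrimaryTorsion (geomPoints (W.baseChange K)) p) (p : ℤ_[p]) := by
    rw [PadicInt.maximalIdeal_eq_span_p]
    exact Submodule.torsionBySet_span_singleton_eq (R := ℤ_[p]) (p : ℤ_[p])
  haveI : Finite (Submodule.torsionBySet ℤ_[p] (PrimaryTorsion (geomPoints (W.baseChange K)) p)
      ((IsLocalRing.maximalIdeal ℤ_[p] : Ideal ℤ_[p]) : Set ℤ_[p])) := by
    rw [hset]
    exact TelescopeK2FibreCofinite.finite_torsionBy_primaryTorsion_geomPoints (W.baseChange K) hpK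
  have hA : ∀ a : PrimaryTorsion (geomPoints (W.baseChange K)) p, ∃ k : ℕ,
      ∀ r ∈ (IsLocalRing.maximalIdeal ℤ_[p]) ^ k, r • a = 0 := by
    intro a
    obtain ⟨k, hk⟩ := a.exists_pow_smul_eq_zero
    refine ⟨k, fun r hr => ?_⟩
    rw [PadicInt.maximalIdeal_eq_span_p, Ideal.span_singleton_pow, Ideal.mem_span_singleton] at hr
    obtain ⟨s, rfl⟩ := hr
    rw [mul_comm, mul_smul, PrimaryTorsion.pow_smul_eq_zero_of a hk, smul_zero]
  obtain ⟨eΛ⟩ := AcTwistDeformation.nonempty_iwasawaAlgebra_ringEquiv_mvPowerSeries (p := p)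
  have hD : IsCofinitelyGenerated (PowerSeries ℤ_[p])
      (BigRepModule ℤ_[p] p (PrimaryTorsion (geomPoints (W.baseChange K)) p)) :=
    TelescopeK2BigRepCofinite.isCofinitelyGenerated_bigRepModule_of_torsion eΛ hA
  -- `X^{unr,Σ}` and `X^{dec,Σ}` are finitely generated for every `Σ ⊆ F`
  have hdecle : ∀ Sig : Set (HeightOneSpectrum (𝓞 K)),
      selmerBigDecomp κ ((W.baseChange K).primaryTorsionGaloisRep p) 𝔭bar Sig ≤
        selmerBig κ ((W.baseChange K).primaryTorsionGaloisRep p) 𝔭bar Sig := by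
    intro Sig z hz
    rw [mem_selmerBig_iff]
    have hz' := (BigGaloisRep.mem_selmer_iff (localMap K) _ _ z).1 hz
    refine ⟨hz' (Sum.inl 𝔭bar) (Or.inl rfl), fun w hw hwp => ?_⟩
    exact Castella2018.resH1_comp_eq_zero_of_resH1_eq_zero _ _ (inertiaIncl K w) z
      (hz' (Sum.inl w) (Or.inr ⟨hw, hwp⟩))
  have hfinX : ∀ Sig : Set (HeightOneSpectrum (𝓞 K)), Sig ⊆ ↑F →
      Module.Finite (PowerSeries ℤ_[p]) (XBig κ ((W.baseChange K).primaryTorsionGaloisRep p) 𝔭bar Sig) := by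
    intro Sig hSig
    exact TelescopeK2SelmerCofinite.module_finite_XBig eΛ κ ((W.baseChange K).primaryTorsionGaloisRep p) hD S₀ hS₀fin hker 𝔭bar Sig
      (fun w hw => ⟨fun h => hw (Set.mem_union_left _ (hSig h)), (hnotS₀ w hw).2⟩)
  have hfinD : ∀ Sig : Set (HeightOneSpectrum (𝓞 K)), Sig ⊆ ↑F →
      Module.Finite (PowerSeries ℤ_[p]) (XBigDecomp κ ((W.baseChange K).primaryTorsionGaloisRep p) 𝔭bar Sig) := by
    intro Sig hSig
    haveI := hfinX Sig hSig
    exact Module.Finite.of_surjective (CharacterModule.dual (Submodule.inclusion (hdecle Sig)))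
      (CharacterModule.dual_surjective_of_injective _ (Submodule.inclusion_injective _))
  -- (c) the local terms at `w ∈ F` (unconditional: JSW / Greenberg–Vatsal 2.4, with the Frobenius of brick #8)
  haveI : ContinuousSMul ℤ_[p] (PrimaryTorsion (geomPoints (W.baseChange K)) p) := continuousSMul_primaryTorsion
  have hloc' : ∀ w ∈ F, ∃ Pw : PowerSeries ℤ_[p],
      Module.Finite (PowerSeries ℤ_[p]) (CharacterModule (continuousCohomology 1
        ((AnticyclotomicBigGaloisRep κ ((W.baseChange K).primaryTorsionGaloisRep p)).restrict (localMap K (Sum.inl w))).toTopRep)) ∧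
      Module.IsTorsion (PowerSeries ℤ_[p]) (CharacterModule (continuousCohomology 1
        ((AnticyclotomicBigGaloisRep κ ((W.baseChange K).primaryTorsionGaloisRep p)).restrict (localMap K (Sum.inl w))).toTopRep)) ∧
      Pw ∈ Literature.NumberTheory.EllipticCurves.Module.charIdeal (PowerSeries ℤ_[p])
        (CharacterModule (continuousCohomology 1
          ((AnticyclotomicBigGaloisRep κ ((W.baseChange K).primaryTorsionGaloisRep p)).restrict (localMap K (Sum.inl w))).toTopRep)) := by
    intro w hwF
    obtain ⟨hNw, hpw⟩ := (hmemF w).1 hwF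
    -- the rational prime `ℓ` under `w` divides `N`, hence splits in `K`: `w` has degree one
    set v : HeightOneSpectrum (𝓞 ℚ) := w.under (𝓞 ℚ) with hv
    haveI hℓ : Fact (Rat.HeightOneSpectrum.primesEquiv v : ℕ).Prime := Fact.mk (Rat.HeightOneSpectrum.primesEquiv v).2
    have hℓv : ((Rat.HeightOneSpectrum.primesEquiv v : ℕ) : 𝓞 ℚ) ∈ v.asIdeal :=
      (natCast_mem_asIdeal_iff_eq_primesEquiv_symm v (Rat.HeightOneSpectrum.primesEquiv v).2).mpr
        (by rw [Subtype.coe_eta, Equiv.symm_apply_apply])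
    have hℓw : ((Rat.HeightOneSpectrum.primesEquiv v : ℕ) : 𝓞 K) ∈ w.asIdeal := by
      have h : algebraMap (𝓞 ℚ) (𝓞 K) ((Rat.HeightOneSpectrum.primesEquiv v : ℕ) : 𝓞 ℚ) ∈ w.asIdeal := by
        rw [← Ideal.mem_comap]; exact hℓv
      rwa [map_natCast] at h
    set ℓ : ℕ := (Rat.HeightOneSpectrum.primesEquiv v : ℕ) with hℓdef
    have hℓN : ℓ ∣ N := by
      by_contra hnd
      have hcop : IsCoprime (ℓ : ℤ) ((N : ℕ) : ℤ) :=
        Nat.isCoprime_iff_coprime.mpr ((Nat.Prime.coprime_iff_not_dvd hℓ.out).mpr hnd)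
      obtain ⟨a, b, hab⟩ := hcop
      apply w.isPrime.ne_top
      rw [Ideal.eq_top_iff_one]
      have h1 : (((a * ℓ + b * N : ℤ)) : 𝓞 K) ∈ w.asIdeal := by
        push_cast
        exact w.asIdeal.add_mem (w.asIdeal.mul_mem_left _ hℓw) (w.asIdeal.mul_mem_left _ hNw)
      rwa [hab, Int.cast_one] at h1
    obtain ⟨he, hf⟩ := X11b.degreeOne_of_splitsIn (K := K) (p := ℓ) hK.1 (hHeeg ℓ hℓ.out hℓN) hℓw
    obtain ⟨φ, c, hφ, hκφ, hc⟩ :=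
      TelescopeK2FinitelyDecomposedFrobenius.exists_isFrobPow_anticyclotomic_ne_zero hK κ hκ w hpw he hf
    haveI := JetchevSkinnerWan2017.moduleFinite_characterModule_h1_absInertia_primaryTorsion (W.baseChange K) p w hpw
    obtain ⟨Lt, hLt⟩ := BigRepModule.exists_quotientTorsion_endo_dual
      (conjMap ((((W.baseChange K).primaryTorsionGaloisRep p).restrict (localMap K (Sum.inl w)) :
        ContinuousRep (absoluteGaloisGroup (w.adicCompletion K)) ℤ_[p]
          (PrimaryTorsion (geomPoints (W.baseChange K)) p))).toTopRep (absInertia (w.adicCompletion K)) φ 1).hom.toLinearMap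
    obtain ⟨h1, h2, h3⟩ := JetchevSkinnerWan2017.sigmaLocal_dual_of_ne_zero (W.baseChange K) p κ w hpw hφ hκφ hc Lt hLt
    exact ⟨_, h1, h2, h3⟩
  -- Σ-change `∅ → ∅ ∪ F`: `X^{dec, ∅ ∪ F}` is torsion
  choose Pf hPf using hloc'
  let Pw : HeightOneSpectrum (𝓞 K) → PowerSeries ℤ_[p] := fun w => if h : w ∈ F then Pf w h else 1
  have hF' : ∀ w ∈ F, w ∉ (∅ : Set (HeightOneSpectrum (𝓞 K))) ∧ ((p : ℕ) : 𝓞 K) ∉ w.asIdeal :=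
    fun w hw => ⟨Set.notMem_empty w, ((hmemF w).1 hw).2⟩
  have hfin' : ∀ F' : Finset (HeightOneSpectrum (𝓞 K)), F' ⊆ F →
      Module.Finite (PowerSeries ℤ_[p])
        (XBigDecomp κ ((W.baseChange K).primaryTorsionGaloisRep p) 𝔭bar ((∅ : Set (HeightOneSpectrum (𝓞 K))) ∪ ↑F')) :=
    fun F' hF'F => hfinD _ (by rw [Set.empty_union]; exact Finset.coe_subset.mpr hF'F)
  obtain ⟨htorF, -⟩ := BigGaloisRep.XBigDecomp.isTorsion_and_charIdeal_mul_span_prod_le κ ((W.baseChange K).primaryTorsionGaloisRep p) 𝔭bar F hF'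
    hfin' htor0 Pw (fun w hw => by
      obtain ⟨h1, h2, h3⟩ := hPf w hw
      exact ⟨h1, h2, by simp only [Pw, dif_pos hw]; exact h3⟩)
    (S₂ := (∅ : Set (HeightOneSpectrum (𝓞 K))) ∪ ↑F) rfl
  haveI : Module.Finite (PowerSeries ℤ_[p])
      (XBigDecomp κ ((W.baseChange K).primaryTorsionGaloisRep p) 𝔭bar ((∅ : Set (HeightOneSpectrum (𝓞 K))) ∪ ↑F)) := hfin' F subset_rfl
  -- (d) `Sel^{unr,∅} ≤ Sel^{dec, ∅ ∪ F}` (`ℋ^{ur}_w = 0` at the good places `w ∉ F`, `w ∤ p`; `p ≠ 2` on Cell C)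
  have hincl : selmerBig κ ((W.baseChange K).primaryTorsionGaloisRep p) 𝔭bar (∅ : Set (HeightOneSpectrum (𝓞 K))) ≤
      selmerBigDecomp κ ((W.baseChange K).primaryTorsionGaloisRep p) 𝔭bar ((∅ : Set (HeightOneSpectrum (𝓞 K))) ∪ ↑F) := by
    intro x hx
    rw [mem_selmerBig_iff] at hx
    rw [selmerBigDecomp, BigGaloisRep.mem_selmer_iff]
    rintro (w | w) hw
    · rcases (inl_mem_strictSetDecomp_iff p 𝔭bar w _).1 hw with rfl | ⟨hwS, hwp⟩
      · exact hx.1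
      · have hwF : w ∉ F := fun h => hwS (Set.mem_union_right _ (Finset.mem_coe.mpr h))
        have hNw : ((N : ℕ) : 𝓞 K) ∉ w.asIdeal := fun h => hwF ((hmemF w).2 ⟨h, hwp⟩)
        exact Castella2018.resH1_anticyclotomicBigRep_localMap_inl_eq_zero_of_inr (W.baseChange K) p κ hp2 hwp (hram w hNw hwp) x
          (hx.2 w (Set.notMem_empty w) hwp)
    · exact (inr_not_mem_strictSetDecomp p 𝔭bar w _ hw).elim
  let π : XBigDecomp κ ((W.baseChange K).primaryTorsionGaloisRep p) 𝔭bar ((∅ : Set (HeightOneSpectrum (𝓞 K))) ∪ ↑F) →ₗ[PowerSeries ℤ_[p]]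
      XBig κ ((W.baseChange K).primaryTorsionGaloisRep p) 𝔭bar (∅ : Set (HeightOneSpectrum (𝓞 K))) :=
    CharacterModule.dual (Submodule.inclusion hincl)
  have hπ : Function.Surjective π :=
    CharacterModule.dual_surjective_of_injective _ (Submodule.inclusion_injective hincl)
  refine ⟨Module.Finite.of_surjective π hπ, fun z => ?_⟩
  obtain ⟨y, rfl⟩ := hπ z
  obtain ⟨d, hd⟩ := @htorF y
  exact ⟨d, by rw [Submonoid.smul_def, ← map_smul, ← Submonoid.smul_def, hd, map_zero]⟩

end Summit.BirchSwinnertonDyer.BirchSwinnertonDyer.Theorems.TelescopeK2XBigUnramifiedCellC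

end
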